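import Summits.HodgeConjecture.CorCM.Census.OcticTwistResidualBlocks

/-!
# The octic twist `(ℤ/8 × B, (4,0))`, XVa: BLOCK PARITIES of the pair model and the TEN RESIDUAL BLOCKS

COR-CM (cell `pub-hodgecm2`), count-neutral kernel combinatorics by the binder seat b09 (gen 34; lane COINVARIANT-TWIST / OCTIC RECON),
on top of parts I–V (`Census/OcticTwist{Model,Motion,Reduction,Cover,ResidualBlocks}.lean`: `Orb₂`, `act`, `transl₂`, `pairs₂`, `spanMot`,
`pot`, `potOrb`, `act_cst_cst`, `act_cst_atom`, `not_rel_cst_cst_cst_atom`, `eq_of_rel_cst_atom`, `exists_of_pot_le_one`,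
`ten_le_card_residual_blocks`) BY NAME; the pattern is §1–2 of the quartic law `Census/QuarticTwistLaw.lean` one dimension up.
Bookkeeping definitions (`orbSet₂`, `parVec₂` — the octic BLOCK PARITIES —, `blkC`, `blkA` — names of the residual blocks —, a classical
`DecidableEq (Orb₂ B)`) + theorems; no `decide` table, no certificate, no named fact, no `sorry`.
HONEST FRAMING: `HC_CM` is NOT proved, here or anywhere in the tree; nothing here is a period or a headline.

* §1 `parVec₂ m = (Σ_{T ∈ ω} m(T) mod 2)_ω` is `ℤ`-linear, kills the octic pairs (`T` and `(2,0)·T` share a block) and is invariant under every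
  motion, so the parities of `pairs₂ ⊔ ℤ[G]·S` lie in the `𝔽₂`-span of the parities of `S` (`parVec₂_mem_span_of_mem`).
* §2 THE TEN RESIDUAL BLOCKS: `C(d) = [(cst 0, cst d)]` (`C(d) = C(−d−1)`: two blocks `{0,3}`, `{1,2}`) and `A(ρ,k) = [(cst 0, ρ + kδ_{b₀})]`
  (`ρ ∈ ℤ/4`, `k = ±1`); the block of every residual shape (`mk_cst_cst`, `mk_cst_atom`, `mk_atom_cst`), when two of them coincide
  (`blkC_eq_blkC_iff`, `blkA_eq_blkA_iff`, `blkA_ne_blkC`), their potentials, and **`card_residual_blocks_eq_ten`**: with part V, EXACTLY ten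
  blocks of octic potential `≤ 1` (`|B| ≥ 3`).  Part XV (`Census/OcticTwistFloor.lean`) builds the parity floor on this.  All [folklore].

## References
* [Pohlmann1968] H. Pohlmann, Algebraic cycles on abelian varieties of complex multiplication type, Ann. of Math. 88 (1968), Thm 1.
-/

namespace Summit.HodgeConjecture.CorCM.Census.OcticTwist

open Finset
open Summit.HodgeConjecture.CorCM.Census.QuarticTwist

variable (B : Type) [AddGroup B] [Fintype B] [DecidableEq B]

/-- Equality of octic blocks is decided classically (bookkeeping). [folklore] -/
noncomputable instance instDecidableEqOrb₂ : DecidableEq (Orb₂ B) := Classical.decEq _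

/-! ## §1 Block sets and block parities -/

/-- The pair types of the block `ω`, as a finite set. [folklore] -/
noncomputable def orbSet₂ (ω : Orb₂ B) : Finset (Ty₂ B) := univ.filter fun T => (Quotient.mk (orbitRel₂ B) T : Orb₂ B) = ω

/-- Membership in `orbSet₂`. [folklore] -/
theorem mem_orbSet₂ {ω : Orb₂ B} {T : Ty₂ B} : T ∈ orbSet₂ B ω ↔ (Quotient.mk (orbitRel₂ B) T : Orb₂ B) = ω := by
  unfold orbSet₂; simp only [mem_filter, mem_univ, true_and]

/-- Motions preserve block sets. [folklore] -/
theorem act_mem_orbSet₂_iff (e : Bool) (h : ZMod 4 × B) {ω : Orb₂ B} {T : Ty₂ B} : act B e h T ∈ orbSet₂ B ω ↔ T ∈ orbSet₂ B ω := by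
  rw [mem_orbSet₂, mem_orbSet₂]
  have hq : (Quotient.mk (orbitRel₂ B) T : Orb₂ B) = Quotient.mk (orbitRel₂ B) (act B e h T) := Quotient.sound ⟨e, h, rfl⟩
  rw [← hq]

/-- The potential is constant on a block. [folklore] -/
theorem pot_eq_potOrb_of_mem {ω : Orb₂ B} {T : Ty₂ B} (hT : T ∈ orbSet₂ B ω) : pot B T = potOrb B ω := by
  rw [mem_orbSet₂] at hT
  rw [← hT, potOrb_mk]

/-- **The octic block parities** `parVec₂ m = (Σ_{T ∈ ω} m(T) mod 2)_ω`, a `ℤ`-linear map to `𝔽₂^{Orb₂}`. [folklore] -/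
noncomputable def parVec₂ : (Ty₂ B → ℤ) →ₗ[ℤ] (Orb₂ B → ZMod 2) where
  toFun m := fun ω => ∑ T ∈ orbSet₂ B ω, (m T : ZMod 2)
  map_add' m m' := by
    funext ω
    simp only [Pi.add_apply, Int.cast_add, Finset.sum_add_distrib]
  map_smul' c m := by
    funext ω
    simp only [Pi.smul_apply, smul_eq_mul, Int.cast_mul, RingHom.id_apply, Finset.mul_sum, zsmul_eq_mul]

/-- `parVec₂` evaluated. [folklore] -/
theorem parVec₂_apply (m : Ty₂ B → ℤ) (ω : Orb₂ B) : parVec₂ B m ω = ∑ T ∈ orbSet₂ B ω, (m T : ZMod 2) := rfl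

/-- `parVec₂` of a unit vector: the indicator of the block of its pair type. [folklore] -/
theorem parVec₂_single (T : Ty₂ B) (c : ℤ) (ω : Orb₂ B) :
    parVec₂ B (Pi.single T c) ω = if T ∈ orbSet₂ B ω then (c : ZMod 2) else 0 := by
  classical
  rw [parVec₂_apply]
  have hterm : ∀ T' ∈ orbSet₂ B ω, ((Pi.single T c : Ty₂ B → ℤ) T' : ZMod 2) = if T = T' then (c : ZMod 2) else 0 := by
    intro T' _
    rw [Pi.single_apply]
    by_cases h : T' = T
    · rw [if_pos h, if_pos h.symm]
    · rw [if_neg h, if_neg (Ne.symm h), Int.cast_zero]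
  rw [Finset.sum_congr rfl hterm, Finset.sum_ite_eq]

/-- `parVec₂` of a unit vector, block form. [folklore] -/
theorem parVec₂_single_one (T : Ty₂ B) (ω : Orb₂ B) :
    parVec₂ B (Pi.single T 1) ω = if ω = Quotient.mk (orbitRel₂ B) T then 1 else 0 := by
  rw [parVec₂_single, Int.cast_one]
  simp only [mem_orbSet₂ B, eq_comm]

/-- **`parVec₂` kills the octic pairs** (`T` and `(T.1 + 2, T.2 + 2) = (2,0)·T` lie in the same block). [folklore] -/
theorem parVec₂_pairVec₂ (T : Ty₂ B) : parVec₂ B (pairVec₂ B T) = 0 := by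
  funext ω
  unfold pairVec₂
  have hact : act B false (2, 0) T = (T.1 + 2, T.2 + 2) := by
    rw [act_false]
    show (tw B (2, 0) T.1, tw B (2, 0) T.2) = _
    rw [tw_two_zero, tw_two_zero]
  have h2 : (T.1 + 2, T.2 + 2) ∈ orbSet₂ B ω ↔ T ∈ orbSet₂ B ω := by rw [← hact]; exact act_mem_orbSet₂_iff B false (2, 0)
  rw [map_add, Pi.add_apply, parVec₂_single, parVec₂_single, Pi.zero_apply]
  by_cases h : T ∈ orbSet₂ B ω
  · rw [if_pos h, if_pos (h2.mpr h), Int.cast_one]; decide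
  · rw [if_neg h, if_neg (fun h' => h (h2.mp h')), add_zero]

/-- **`parVec₂` is invariant under every motion.** [folklore] -/
theorem parVec₂_transl₂ (e : Bool) (h : ZMod 4 × B) (v : Ty₂ B → ℤ) : parVec₂ B (transl₂ B e h v) = parVec₂ B v := by
  funext ω
  rw [parVec₂_apply, parVec₂_apply]
  refine Finset.sum_bij (fun T _ => actInv B e h T) (fun T hT => ?_) ?_ ?_ (fun T _ => rfl)
  · have := (act_mem_orbSet₂_iff B e h (ω := ω) (T := actInv B e h T))
    rw [act_actInv] at this
    exact this.mp hT
  · intro T₁ _ T₂ _ hT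
    have := congrArg (act B e h) hT
    rwa [act_actInv, act_actInv] at this
  · intro T hT
    exact ⟨act B e h T, (act_mem_orbSet₂_iff B e h).mpr hT, actInv_act B e h T⟩

/-- **The parities of `pairs₂ ⊔ ℤ[G]·S` lie in the `𝔽₂`-span of the parities of `S`.** [folklore] -/
theorem parVec₂_mem_span_of_mem (S : Finset (Ty₂ B → ℤ)) {m : Ty₂ B → ℤ} (hm : m ∈ pairs₂ B ⊔ spanMot B S) :
    parVec₂ B m ∈ Submodule.span (ZMod 2) ((S.image (parVec₂ B) : Finset _) : Set (Orb₂ B → ZMod 2)) := by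
  classical
  set T := Submodule.span (ZMod 2) ((S.image (parVec₂ B) : Finset _) : Set (Orb₂ B → ZMod 2)) with hT
  have hle : pairs₂ B ⊔ spanMot B S ≤ (T.restrictScalars ℤ).comap (parVec₂ B) := by
    refine sup_le (Submodule.span_le.mpr ?_) (Submodule.span_le.mpr ?_)
    · rintro _ ⟨ψ, rfl⟩
      show parVec₂ B (pairVec₂ B ψ) ∈ T
      rw [parVec₂_pairVec₂]; exact T.zero_mem
    · rintro _ ⟨e, g, f, hf, rfl⟩
      show parVec₂ B (transl₂ B e g f) ∈ T
      rw [parVec₂_transl₂]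
      exact Submodule.subset_span (Finset.mem_coe.mpr (Finset.mem_image_of_mem _ hf))
  exact hle hm

/-! ## §2 The ten residual blocks `C(d)`, `A(ρ, k)` and the blocks of the residual shapes -/

/-- The constant-constant block `C(d) = [(cst 0, cst d)]`. [folklore] -/
noncomputable def blkC (d : ZMod 4) : Orb₂ B := Quotient.mk (orbitRel₂ B) (cst B 0, cst B d)

/-- The constant-atom block `A(ρ, k) = [(cst 0, ρ + kδ_{b₀})]`. [folklore] -/
noncomputable def blkA (b₀ : B) (ρ k : ZMod 4) : Orb₂ B := Quotient.mk (orbitRel₂ B) (cst B 0, atom B ρ b₀ k)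

omit [Fintype B] [DecidableEq B] in
/-- Block of a constant-constant type: `[(cst u, cst u′)] = C(u′ − u)`. [folklore] -/
theorem mk_cst_cst (u u' : ZMod 4) : (Quotient.mk (orbitRel₂ B) (cst B u, cst B u') : Orb₂ B) = blkC B (u' - u) := by
  refine Quotient.sound ⟨false, ((-u : ZMod 4), (0 : B)), ?_⟩
  rw [act_cst_cst]
  simp only [Bool.false_eq_true, if_false]
  rw [add_neg_cancel, ← sub_eq_add_neg]

omit [Fintype B] in
/-- Block of a constant-atom type: `[(cst u, r + kδ_b)] = A(r − u, k)`. [folklore] -/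
theorem mk_cst_atom (b₀ : B) (u r : ZMod 4) (b : B) (k : ZMod 4) :
    (Quotient.mk (orbitRel₂ B) (cst B u, atom B r b k) : Orb₂ B) = blkA B b₀ (r - u) k := by
  refine Quotient.sound ⟨false, ((-u : ZMod 4), -b₀ + b), ?_⟩
  rw [act_cst_atom]
  simp only [Bool.false_eq_true, if_false]
  rw [add_neg_cancel, ← sub_eq_add_neg, sub_neg_add_self]

omit [Fintype B] in
/-- Block of an atom-constant type: `[(r + kδ_b, cst u)] = A(r − u − 1, k)` (one swap-twist away). [folklore] -/
theorem mk_atom_cst (b₀ : B) (u r : ZMod 4) (b : B) (k : ZMod 4) :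
    (Quotient.mk (orbitRel₂ B) (atom B r b k, cst B u) : Orb₂ B) = blkA B b₀ (r - u - 1) k := by
  symm
  refine Quotient.sound ⟨true, (u, -b + b₀), ?_⟩
  rw [act_cst_atom]
  simp only [if_true]
  rw [sub_neg_add_self, zero_add, show r - u - 1 + 1 + u = r by ring]

omit [Fintype B] [DecidableEq B] in
/-- `C(d) = C(−d − 1)` (the swap-twist on constant-constant types). [folklore] -/
theorem blkC_eq_blkC_neg (d : ZMod 4) : blkC B d = blkC B (-d - 1) := by
  refine Quotient.sound ⟨true, ((-d - 1 : ZMod 4), (0 : B)), ?_⟩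
  rw [act_cst_cst]
  simp only [if_true]
  rw [zero_add, show d + 1 + (-d - 1) = 0 by ring]

omit [Fintype B] [DecidableEq B] in
/-- **When are two constant-constant blocks equal**: `C(d) = C(d′) ↔ d = d′ ∨ d = −d′ − 1` (`B` non-empty). [folklore] -/
theorem blkC_eq_blkC_iff [Nonempty B] (d d' : ZMod 4) : blkC B d = blkC B d' ↔ d = d' ∨ d = -d' - 1 := by
  constructor
  · intro h
    obtain ⟨e, g, hact⟩ := Quotient.exact h
    rw [act_cst_cst] at hact
    obtain ⟨b⟩ := ‹Nonempty B›
    cases e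
    · simp only [Bool.false_eq_true, if_false] at hact
      have h1 := congrFun (Prod.ext_iff.mp hact).1 b
      have h2 := congrFun (Prod.ext_iff.mp hact).2 b
      simp only [cst, zero_add] at h1 h2
      left
      rw [← h2, h1, add_zero]
    · simp only [if_true] at hact
      have h1 := congrFun (Prod.ext_iff.mp hact).1 b
      have h2 := congrFun (Prod.ext_iff.mp hact).2 b
      simp only [cst, zero_add] at h1 h2
      right
      rw [← h2]
      have : d = -(1 + g.1) := eq_neg_of_add_eq_zero_left (by rw [← add_assoc]; exact h1)
      rw [this]; ring
  · rintro (rfl | rfl)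
    · rfl
    · rw [← blkC_eq_blkC_neg]

/-- **A constant-atom block is not a constant-constant block** (`|B| ≥ 3`, `k ≠ 0`). [folklore] -/
theorem blkA_ne_blkC (h3 : 3 ≤ Fintype.card B) (b₀ : B) (ρ : ZMod 4) {k : ZMod 4} (hk : k ≠ 0) (d : ZMod 4) :
    blkA B b₀ ρ k ≠ blkC B d := fun h =>
  not_rel_cst_cst_cst_atom B h3 d ρ b₀ hk (Quotient.exact h.symm)

/-- **When are two constant-atom blocks equal**: `A(ρ,k) = A(ρ′,k′) ↔ ρ = ρ′ ∧ k = k′` (`|B| ≥ 3`, `k ≠ 0`). [folklore] -/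
theorem blkA_eq_blkA_iff (h3 : 3 ≤ Fintype.card B) (b₀ : B) {ρ ρ' k k' : ZMod 4} (hk : k ≠ 0) :
    blkA B b₀ ρ k = blkA B b₀ ρ' k' ↔ ρ = ρ' ∧ k = k' := by
  constructor
  · intro h
    exact eq_of_rel_cst_atom B h3 b₀ hk (Quotient.exact h)
  · rintro ⟨rfl, rfl⟩
    rfl

/-- Potentials of the residual blocks: `Φ₂(C(d)) = 0`, `Φ₂(A(ρ, ±1)) = 1` (`|B| ≥ 3`). [folklore] -/
theorem potOrb_blk (h3 : 3 ≤ Fintype.card B) (b₀ : B) (d ρ : ZMod 4) {k : ZMod 4} (hk : k = 1 ∨ k = -1) :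
    potOrb B (blkC B d) = 0 ∧ potOrb B (blkA B b₀ ρ k) = 1 := by
  refine ⟨?_, ?_⟩
  · show pot B (cst B 0, cst B d) = 0
    exact pot_cst_cst B h3 b₀ 0 d
  · show pot B (cst B 0, atom B ρ b₀ k) = 1
    exact pot_cst_atom B h3 0 ρ b₀ hk

/-- **AT MOST TEN RESIDUAL BLOCKS** (`|B| ≥ 3`): every block of potential `≤ 1` is a `C(d)`, `d ∈ {0,1}`, or an `A(ρ, ±1)`. [folklore] -/
theorem card_residual_blocks_le_ten (h3 : 3 ≤ Fintype.card B) : Fintype.card {ω : Orb₂ B // potOrb B ω ≤ 1} ≤ 10 := by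
  classical
  obtain ⟨b₀⟩ : Nonempty B := Fintype.card_pos_iff.mp (by omega)
  let sgn : Bool → ZMod 4 := fun ε => if ε then 1 else -1
  let f : Bool ⊕ (Bool × ZMod 4) → Orb₂ B := fun i =>
    match i with
    | Sum.inl d => blkC B (if d then 1 else 0)
    | Sum.inr (ε, r) => blkA B b₀ r (sgn ε)
  have hsurj : ∀ ω : Orb₂ B, potOrb B ω ≤ 1 → ∃ i, f i = ω := by
    intro ω hω
    induction ω using Quotient.inductionOn with
    | h T =>
    rw [potOrb_mk] at hω
    rcases exists_of_pot_le_one B hω with ⟨u, u', rfl⟩ | ⟨u, u', b, k, hk, rfl | rfl⟩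
    · -- constant-constant: `C(u′ − u)`, normalised to `d ∈ {0,1}`
      have key : ∀ d : ZMod 4, (d = 0 ∨ d = -(0 : ZMod 4) - 1) ∨ (d = 1 ∨ d = -(1 : ZMod 4) - 1) := by decide
      rcases key (u' - u) with hd | hd
      · refine ⟨Sum.inl false, ?_⟩
        show blkC B 0 = _
        rw [mk_cst_cst]
        exact ((blkC_eq_blkC_iff B (u' - u) 0).mpr hd).symm
      · refine ⟨Sum.inl true, ?_⟩
        show blkC B 1 = _
        rw [mk_cst_cst]
        exact ((blkC_eq_blkC_iff B (u' - u) 1).mpr hd).symm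
    · rcases hk with rfl | rfl
      · exact ⟨Sum.inr (true, u' - u), by show blkA B b₀ (u' - u) 1 = _; rw [mk_cst_atom B b₀]⟩
      · exact ⟨Sum.inr (false, u' - u), by show blkA B b₀ (u' - u) (-1) = _; rw [mk_cst_atom B b₀]⟩
    · rcases hk with rfl | rfl
      · exact ⟨Sum.inr (true, u' - u - 1), by show blkA B b₀ (u' - u - 1) 1 = _; rw [mk_atom_cst B b₀]⟩
      · exact ⟨Sum.inr (false, u' - u - 1), by show blkA B b₀ (u' - u - 1) (-1) = _; rw [mk_atom_cst B b₀]⟩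
  choose g hg using fun ω : {ω : Orb₂ B // potOrb B ω ≤ 1} => hsurj ω.1 ω.2
  have hinj : Function.Injective g := fun ω ω' h => Subtype.ext (by rw [← hg ω, ← hg ω', h])
  have := Fintype.card_le_of_injective g hinj
  simpa using this

/-- **EXACTLY TEN RESIDUAL BLOCKS** (`|B| ≥ 3`; with part V `ten_le_card_residual_blocks`). [folklore] -/
theorem card_residual_blocks_eq_ten (h3 : 3 ≤ Fintype.card B) : Fintype.card {ω : Orb₂ B // potOrb B ω ≤ 1} = 10 :=
  le_antisymm (card_residual_blocks_le_ten B h3) (ten_le_card_residual_blocks B h3)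

end Summit.HodgeConjecture.CorCM.Census.OcticTwist
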